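import Summits.BirchSwinnertonDyer.BirchSwinnertonDyer.Theorems.KatoDescentPotSupersingularASideCountPPart
import Literature.NumberTheory.EllipticCurves.Kato2004.ZetaLineLocalIndex
import HarnessLib

/-!
# The level-0 count of crux M from the Literature predicate `Kato2004.ZetaLineOrthIndexAt` (brick (b′), pairing form, with the Weil datum
# NON-DEGENERATE and ALTERNATING): `p^{v_p(Tam W)}·#Ш(W)[p^∞]·[A : ℤ_p y₀] ≤ p^{v_p(c_p)}·#Sel_str^{ur}(W[p^∞])·p^e·(p^{v_p #W(ℚ)_tors})²`
# (route `KatoDescentPotSupersingular` / `…Tame…`, crux M = stmt-BirchSwinnertonDyer-19196; route-free helper)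

Seat `bsd-potss-rkm` g21 (prover; cell `bsd-potss`), item stmt-BirchSwinnertonDyer-19196 (`--supports … --as helper`; closes nothing).
HONEST FRAMING: BSD is not proved by any of this; nothing is booked; theorems only (no definition, no named fact).  CONDITIONAL on the named fact
`poitouTate_selmerStructure_duality ℚ` and on the displayed Literature predicate `ZetaLineOrthIndexAt W p y₀ e` (Kato Prop. 14.16 (2) `ν` /
Lemma 14.18 — a clause of the held package `Kato2004.MemberHullZetaCoreInputs`, NOT proved here).

## What (and a repair of parts 53–56)

Parts 53–56 (`…ASideCountOfZetaLineIndex`, `…ASideCountPPart`, `…ASideZetaLinePairingForm`, `…ASideZetaClassForm`) take brick (b) as a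
hypothesis quantified over EVERY bilinear `Γ_ℚ`-equivariant `μ`-valued `ε` on `W[p^j p^k]` — including the TRIVIAL pairing, for which the
descended dual map is zero, the zeta line's image `B_k(ℤ_p y₀)` is `0`, its index `r_k` is `1`, and «`p^k ∣ r_k·p^e` for all large `k`» FAILS: as
typed, their hypothesis `hb` is unsatisfiable.  The proofs only ever instantiate `hb` at the genuine Weil pairing of `exists_weilPairing_holds`,
which is alternating and non-degenerate; the Literature predicate `Kato2004.ZetaLineOrthIndexAt` (p629417) quantifies over those only, in the
«membership ⇒ divisibility» form `f_k(c·y₀) ⊥ 𝓚_k ⇒ p^k ∣ c·p^e`.  This file re-proves the count from it: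

* `nsmul_relIndex_inf_mem` — for subgroups `B, L` and `g ∈ B`: `[B : B ⊓ L] • g ∈ L` (the order of `g` modulo `L` divides the index);
* `pow_dvd_relIndex_mul_pow_of_zetaLineOrthIndexAt` — from `ZetaLineOrthIndexAt W p y₀ e`, at every level `k ≥ k₁`, every `j`, every
  Poitou–Tate family and every NON-DEGENERATE ALTERNATING Weil datum: `p^k ∣ [B_k(ℤ_p y₀) : B_k(ℤ_p y₀) ⊓ 𝓚_k^⊥] · p^e` (take
  `c = [B_k : B_k ⊓ 𝓚_k^⊥]`, whose multiple of `f_k(y₀)` lies in `𝓚_k^⊥`);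
* **`tamagawa_mul_sha_mul_index_le_ppart_of_zetaLineOrthIndexAt`** — part 54's count with `hb` replaced by `ZetaLineOrthIndexAt W p y₀ e`
  (same proof: part 52 at `k = max(k₀,k₁,N+e)+1`, the genuine Weil data kept with `halt`, `hnondeg`).

References: K. Kato, Astérisque 295 (2004), Prop. 14.16 and its proof (pp. 244–245), Lemma 14.18 (pp. 247–248) [Kato2004Asterisque];
J. S. Milne, *ADT* I Cor. 2.3, Thm. 4.10 (b) [MilneADT2006]; J. H. Silverman, *AEC* III.8.1 [SilvermanAEC2009].
-/

-- the summit and its single problem are both named `BirchSwinnertonDyer` (registry layout D-0017)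
set_option linter.dupNamespace false
set_option autoImplicit false

noncomputable section

open scoped Classical ContRepresentation NumberField AddSubgroup
open CategoryTheory Function Field NumberField IsDedekindDomain WeierstrassCurve
open Literature.NumberTheory.EllipticCurves Literature.NumberTheory.GaloisRepresentations
  Literature.NumberTheory.GaloisRepresentations.DiscreteGaloisModule Literature.NumberTheory.GaloisCohomology
open Literature.NumberTheory.EllipticCurves.Kato2004 Literature.NumberTheory.EllipticCurves.Kato2004.EulerSystemValues
open Summit.BirchSwinnertonDyer.Rank1Residual.X11b.Levels Summit.BirchSwinnertonDyer.Rank1Residual.X11b.LocBridge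
  Summit.BirchSwinnertonDyer.Rank1Residual.X11b.LevelKummer Summit.BirchSwinnertonDyer.Rank1Residual.X11b.FiniteDuality
  Summit.BirchSwinnertonDyer.Rank1Residual.X11b.AcSelmer
open Summit.BirchSwinnertonDyer.Rank1Residual.GaloisImage
open Summit.BirchSwinnertonDyer.BirchSwinnertonDyer.Theorems.KummerTowerOrthogonal
open Summit.BirchSwinnertonDyer.BirchSwinnertonDyer.Theorems.ASideJunction

namespace Summit.BirchSwinnertonDyer.BirchSwinnertonDyer.Theorems.KatoFiniteLevelCount

/-! ## §1 The order of a generator modulo a subgroup divides the relative index -/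

section RelIndex

/-- **`[B : B ⊓ L] • g ∈ L` for `g ∈ B`** (abelian groups; `AddSubgroup.nsmul_relIndex_mem`). [cite: MilneADT2006, Ch. I §0 (finite abelian groups)] -/
theorem nsmul_relIndex_inf_mem {G : Type*} [AddCommGroup G] (B L : AddSubgroup G) {g : G} (hg : g ∈ B) :
    (B ⊓ L).relIndex B • g ∈ L :=
  ((B ⊓ L).nsmul_relIndex_mem hg).2

end RelIndex

/-! ## §2 Brick (b″) from the Literature predicate -/

section Brick

variable (W : WeierstrassCurve ℚ) [W.IsElliptic] (p : ℕ) [Fact p.Prime] [ContinuousSMul ℤ_[p] (W.tateModule p)]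

/-- **`ZetaLineOrthIndexAt W p y₀ e` gives brick (b″) at every genuine Weil datum:
`p^k ∣ [B_k(ℤ_p y₀) : B_k(ℤ_p y₀) ⊓ 𝓚_k^⊥] · p^e`** for `k ≥ k₁`, every `j`, every Poitou–Tate family `inv` (sum zero, perfect) and every
bilinear `Γ_ℚ`-equivariant `μ`-valued ALTERNATING NON-DEGENERATE `ε` on `W[p^j p^k]`: the multiple `r_k • f_k(y₀) = f_k(r_k • y₀)`,
`r_k = [B_k : B_k ⊓ 𝓚_k^⊥]`, lies in `𝓚_k^⊥`, so the predicate gives `p^k ∣ r_k · p^e`.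
[cite: Kato2004Asterisque, Prop. 14.16 (2) (p. 244) and Lemma 14.18 (pp. 247–248)] [cite: MilneADT2006, Ch. I, Cor. 2.3] -/
theorem pow_dvd_relIndex_mul_pow_of_zetaLineOrthIndexAt (y₀ : H1 (tateRep W p) ⊤) (e : ℕ) (hb : ZetaLineOrthIndexAt W p y₀ e) :
    ∃ k₁ : ℕ, ∀ k : ℕ, k₁ ≤ k → ∀ j : ℕ,
      haveI := neZero_pow p j; haveI := neZero_pow p k
      haveI : Finite (geomTorsion W ((p ^ k : ℕ) : ℤ)) := finite_geomTorsion_pow W p k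
      ∀ (inv : LocalInvariants ℚ (p ^ j * p ^ k)), inv.SumLocalTermEqZero → inv.IsPerfect →
      ∀ (ε : geomTorsion W ((p ^ j * p ^ k : ℕ) : ℤ) → geomTorsion W ((p ^ j * p ^ k : ℕ) : ℤ) → AlgebraicClosure ℚ)
        (hμ : ∀ S T, ε S T ^ (p ^ j * p ^ k) = 1)
        (hadd₁ : ∀ S₁ S₂ T, ε (S₁ + S₂) T = ε S₁ T * ε S₂ T)
        (hadd₂ : ∀ S T₁ T₂, ε S (T₁ + T₂) = ε S T₁ * ε S T₂)
        (hgal : ∀ (σ : absoluteGaloisGroup ℚ) (S T : geomTorsion W ((p ^ j * p ^ k : ℕ) : ℤ)), σ • ε S T = ε (σ • S) (σ • T)),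
        (∀ T, ε T T = 1) → (∀ T, (∀ S, ε S T = 1) → T = 0) →
      p ^ k ∣ ((((ℤ_[p] ∙ y₀).toAddSubgroup.map
                  (((galoisCohomology.map (W.torsionInclusion (intPow_dvd_natCast_pow p k)) 1).comp
                      (ofTopSubgroup (W.torsionGaloisModule ((p : ℤ) ^ k)).toTopRep 1).hom.toLinearMap.toAddMonoidHom).comp
                    (reduceH1Pk W p k ⊤))).map
                  (galoisCohomology.map (DiscreteGaloisModule.pairingDualIntertwining
                    (ρ₁ := W.torsionGaloisModule ((p ^ k : ℕ) : ℤ)) (ρ₂ := W.torsionGaloisModule ((p ^ k : ℕ) : ℤ))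
                    (B := descendHom W (p ^ j) (p ^ k) ε hμ hadd₁ hadd₂)
                    (descendHom_smul W (p ^ j) (p ^ k) ε hμ hadd₁ hadd₂ hgal)) 1)).map
                (galoisCohomology.localization ((W.torsionGaloisModule ((p ^ k : ℕ) : ℤ)).tateDual (p ^ j * p ^ k))
                  (Sum.inr (primePlace p)) 1) ⊓
              annRight (localTatePairingZMod (W.torsionGaloisModule ((p ^ k : ℕ) : ℤ)) (p ^ j * p ^ k)
                (Sum.inr (primePlace p)) (inv (Sum.inr (primePlace p))))
                (W.kummerSelmerStructure ((p ^ k : ℕ) : ℤ) (Sum.inr (primePlace p)))).relIndex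
              ((((ℤ_[p] ∙ y₀).toAddSubgroup.map
                  (((galoisCohomology.map (W.torsionInclusion (intPow_dvd_natCast_pow p k)) 1).comp
                      (ofTopSubgroup (W.torsionGaloisModule ((p : ℤ) ^ k)).toTopRep 1).hom.toLinearMap.toAddMonoidHom).comp
                    (reduceH1Pk W p k ⊤))).map
                  (galoisCohomology.map (DiscreteGaloisModule.pairingDualIntertwining
                    (ρ₁ := W.torsionGaloisModule ((p ^ k : ℕ) : ℤ)) (ρ₂ := W.torsionGaloisModule ((p ^ k : ℕ) : ℤ))
                    (B := descendHom W (p ^ j) (p ^ k) ε hμ hadd₁ hadd₂)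
                    (descendHom_smul W (p ^ j) (p ^ k) ε hμ hadd₁ hadd₂ hgal)) 1)).map
                (galoisCohomology.localization ((W.torsionGaloisModule ((p ^ k : ℕ) : ℤ)).tateDual (p ^ j * p ^ k))
                  (Sum.inr (primePlace p)) 1)) * p ^ e := by
  obtain ⟨k₁, hb⟩ := hb
  refine ⟨k₁, fun k hk j => ?_⟩
  intro inv hsum hperf ε hμ hadd₁ hadd₂ hgal halt hnondeg
  haveI := neZero_pow p j; haveI := neZero_pow p k
  haveI : Finite (geomTorsion W ((p ^ k : ℕ) : ℤ)) := finite_geomTorsion_pow W p k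
  -- the three maps
  let f₁ : H1 (tateRep W p) ⊤ →+ galoisCohomology (W.torsionGaloisModule ((p ^ k : ℕ) : ℤ)) 1 :=
    ((galoisCohomology.map (W.torsionInclusion (intPow_dvd_natCast_pow p k)) 1).comp
        (ofTopSubgroup (W.torsionGaloisModule ((p : ℤ) ^ k)).toTopRep 1).hom.toLinearMap.toAddMonoidHom).comp
      (reduceH1Pk W p k ⊤)
  let f₂ : galoisCohomology (W.torsionGaloisModule ((p ^ k : ℕ) : ℤ)) 1 →+
      galoisCohomology ((W.torsionGaloisModule ((p ^ k : ℕ) : ℤ)).tateDual (p ^ j * p ^ k)) 1 :=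
    galoisCohomology.map (DiscreteGaloisModule.pairingDualIntertwining
      (ρ₁ := W.torsionGaloisModule ((p ^ k : ℕ) : ℤ)) (ρ₂ := W.torsionGaloisModule ((p ^ k : ℕ) : ℤ))
      (B := descendHom W (p ^ j) (p ^ k) ε hμ hadd₁ hadd₂)
      (descendHom_smul W (p ^ j) (p ^ k) ε hμ hadd₁ hadd₂ hgal)) 1
  let f₃ : galoisCohomology ((W.torsionGaloisModule ((p ^ k : ℕ) : ℤ)).tateDual (p ^ j * p ^ k)) 1 →+
      galoisCohomology (((W.torsionGaloisModule ((p ^ k : ℕ) : ℤ)).tateDual (p ^ j * p ^ k)).toLocal (Sum.inr (primePlace p))) 1 :=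
    galoisCohomology.localization ((W.torsionGaloisModule ((p ^ k : ℕ) : ℤ)).tateDual (p ^ j * p ^ k)) (Sum.inr (primePlace p)) 1
  let B : AddSubgroup _ := (((ℤ_[p] ∙ y₀).toAddSubgroup.map f₁).map f₂).map f₃
  let L : AddSubgroup _ := annRight (localTatePairingZMod (W.torsionGaloisModule ((p ^ k : ℕ) : ℤ)) (p ^ j * p ^ k)
    (Sum.inr (primePlace p)) (inv (Sum.inr (primePlace p)))) (W.kummerSelmerStructure ((p ^ k : ℕ) : ℤ) (Sum.inr (primePlace p)))
  show p ^ k ∣ (B ⊓ L).relIndex B * p ^ e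
  -- the generator of the zeta line's image and its `r`-th multiple
  set r : ℕ := (B ⊓ L).relIndex B with hr
  have hg : f₃ (f₂ (f₁ y₀)) ∈ B :=
    ⟨f₂ (f₁ y₀), ⟨f₁ y₀, ⟨y₀, Submodule.mem_span_singleton_self y₀, rfl⟩, rfl⟩, rfl⟩
  have hmem : r • f₃ (f₂ (f₁ y₀)) ∈ L := nsmul_relIndex_inf_mem B L hg
  have hmul : r • f₃ (f₂ (f₁ y₀)) = f₃ (f₂ (f₁ ((r : ℤ) • y₀))) := by
    rw [map_zsmul, map_zsmul, map_zsmul, natCast_zsmul]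
  rw [hmul] at hmem
  -- the predicate at `c = r`
  have hdiv : ((p ^ k : ℕ) : ℤ) ∣ (r : ℤ) * p ^ e :=
    hb k hk j inv hsum hperf ε hμ hadd₁ hadd₂ hgal halt hnondeg (r : ℤ)
      (fun x hx => (mem_annRight_iff _ _ _).mp hmem x hx)
  exact_mod_cast hdiv

end Brick

/-! ## §3 The count -/

section Count

variable (W : WeierstrassCurve ℚ) [W.IsElliptic] (p : ℕ) [Fact p.Prime] [ContinuousSMul ℤ_[p] (W.tateModule p)]
  (𝓤inf 𝓢inf : SelmerStructure (primaryGaloisModule W p))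

/-- **THE LEVEL-0 COUNT OF CRUX M FROM THE LITERATURE PREDICATE `ZetaLineOrthIndexAt`:
`p^{v_p(Tam W)} · #Ш(W)[p^∞] · [A : ℤ_p y₀] ≤ p^{v_p(c_p)} · #Sel_str^{ur}(W[p^∞]) · p^e · (p^{v_p #W(ℚ)_tors})²`** — `W(ℚ)` finite, `Ш(W)[p^∞]` finite, `p` odd,
`y₀ ∈ A = H¹(ℤ[1/p], T_pW)` with `p^N A ⊆ ℤ_p y₀`, the zeta line's local index at `p` at least `p^e` in the pairing form (`ZetaLineOrthIndexAt W p y₀ e`, Kato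
Prop. 14.16 (2) `ν` / Lemma 14.18; displayed, not proved), and the named fact `poitouTate_selmerStructure_duality ℚ` (the PT families; the Weil data come from the
PROVED `exists_weilPairing_holds`, used WITH their alternating and non-degeneracy clauses).  Part 52 at `k = max(k₀,k₁,N+e)+1`, the level `p^k` cancelled
against §2, `#W(ℚ)[p^k]·#W(ℚ)[p^N] ∣ (p^{v_p #W(ℚ)_tors})²`.
[cite: Kato2004Asterisque, §14.8 (p. 238), (14.9.3) (p. 240), Prop. 14.16 and its proof (pp. 244–245), Lemma 14.18 (pp. 247–248)]
[cite: MilneADT2006, Ch. I, Cor. 2.3, Thm. 4.10 (b)] [cite: Howard2004HeegnerKolyvagin, Thm. 2.1.11] [cite: SilvermanAEC2009, Prop. III.8.1] -/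
theorem tamagawa_mul_sha_mul_index_le_ppart_of_zetaLineOrthIndexAt (hPT : poitouTate_selmerStructure_duality ℚ) (hodd : p ≠ 2)
    (T : Finset (HeightOneSpectrum (𝓞 ℚ)))
    (hpT : primePlace p ∈ T) (hT : ∀ v : HeightOneSpectrum (𝓞 ℚ), v ∉ T → W.HasGoodReductionAt v)
    [Finite W.toAffine.Point] [Finite (AddCommGroup.primaryComponent (↥W.sha) p)]
    (hUp : 𝓤inf (Sum.inr (primePlace p)) = ⊤)
    (hUur : ∀ v : HeightOneSpectrum (𝓞 ℚ), v ≠ primePlace p →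
      𝓤inf (Sum.inr v) = unramifiedSubgroup (GaloisRep.toLocal v (primaryGaloisModule W p)) 1)
    (hUinl : ∀ w : InfinitePlace ℚ, 𝓤inf (Sum.inl w) = ⊤)
    (hSp : 𝓢inf (Sum.inr (primePlace p)) = ⊥)
    (hSur : ∀ v : HeightOneSpectrum (𝓞 ℚ), v ≠ primePlace p →
      𝓢inf (Sum.inr v) = unramifiedSubgroup (GaloisRep.toLocal v (primaryGaloisModule W p)) 1)
    (hSinl : ∀ w : InfinitePlace ℚ, 𝓢inf (Sum.inl w) = ⊤)
    (y₀ : H1 (tateRep W p) ⊤) (hy₀ : y₀ ∈ integralH1 (tateRep W p) p ⊤) (N : ℕ)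
    (hN : ∀ a ∈ integralH1 (tateRep W p) p ⊤, ((p ^ N : ℕ) : ℤ) • a ∈ (ℤ_[p] ∙ y₀).toAddSubgroup) (e : ℕ)
    (hb : ZetaLineOrthIndexAt W p y₀ e) :
    p ^ padicValNat p W.tamagawaProduct * Nat.card (AddCommGroup.primaryComponent (↥W.sha) p) *
        (ℤ_[p] ∙ y₀).toAddSubgroup.relIndex (integralH1 (tateRep W p) p ⊤).toAddSubgroup ≤
      p ^ padicValNat p ((W.baseChange ((primePlace p).adicCompletion ℚ)).localTamagawaNumber
          ((primePlace p).adicCompletionIntegers ℚ)) * Nat.card 𝓢inf.selmerGroup * p ^ e * (p ^ padicValNat p W.torsionOrder) ^ 2 := by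
  have hp : p.Prime := Fact.out
  obtain ⟨k₁, hb⟩ := pow_dvd_relIndex_mul_pow_of_zetaLineOrthIndexAt W p y₀ e hb
  obtain ⟨j, s, k₀, hA⟩ :=
    exists_forall_aSide_le_classical_of_dvd W p 𝓤inf 𝓢inf hodd T hpT hT hUp hUur hUinl hSp hSur hSinl y₀ hy₀ N hN
  -- the level
  obtain ⟨k, hk₀, hk₁, hNe, hk1⟩ : ∃ k : ℕ, k₀ ≤ k ∧ k₁ ≤ k ∧ N + e ≤ k ∧ 1 ≤ k :=
    ⟨max (max k₀ k₁) (N + e) + 1, by omega, by omega, by omega, by omega⟩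
  haveI := neZero_pow p j; haveI := neZero_pow p s; haveI := neZero_pow p k
  haveI : Finite (geomTorsion W ((p ^ k : ℕ) : ℤ)) := finite_geomTorsion_pow W p k
  haveI : Finite (geomTorsion W ((p ^ s * p ^ k : ℕ) : ℤ)) :=
    W.finite_torsionPoints_holds (AlgebraicClosure ℚ) (Int.natCast_ne_zero.mpr (NeZero.ne (p ^ s * p ^ k)))
  have hpk2 : 2 ≤ p ^ k := le_trans hp.two_le (Nat.le_self_pow (by omega) p)
  -- the Poitou–Tate families and the GENUINE Weil data at the two auxiliary levels (alternating, non-degenerate)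
  obtain ⟨inv, hperf, hsum, -, -⟩ := hPT (p ^ j * p ^ k)
  obtain ⟨ε, hμ, hadd₁, hadd₂, halt, hnondeg, hgal⟩ := (W.exists_weilPairing_holds (p ^ j * p ^ k))
    (le_trans hpk2 (Nat.le_mul_of_pos_left _ (pow_pos hp.pos j))) (Nat.cast_ne_zero.mpr (NeZero.ne (p ^ j * p ^ k)))
  obtain ⟨inv', hperf', -, -, hcompl'⟩ := hPT (p ^ s * p ^ k)
  obtain ⟨e', hμ', hadd₁', hadd₂', halt', hnondeg', hgal'⟩ := (W.exists_weilPairing_holds (p ^ s * p ^ k))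
    (le_trans hpk2 (Nat.le_mul_of_pos_left _ (pow_pos hp.pos s))) (Nat.cast_ne_zero.mpr (NeZero.ne (p ^ s * p ^ k)))
  -- brick (b″) at the level `k`: `p^k ∣ r·p^e`, hence `p^N ∣ r` and `p^k ≤ r·p^e`
  have hbk := hb k hk₁ j inv hsum hperf ε hμ hadd₁ hadd₂ hgal halt hnondeg
  have hdvd := pow_dvd_of_pow_dvd_mul_pow hp.pos hbk hNe
  haveI : Finite (galoisCohomology (((W.torsionGaloisModule ((p ^ k : ℕ) : ℤ)).tateDual (p ^ j * p ^ k)).toLocal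
      (Sum.inr (primePlace p))) 1) := finite_galoisCohomology_one_tateDual_toLocal _ _ _
  have hrle := le_of_dvd_mul_of_ne_zero hbk (relIndex_ne_zero_of_finite _ _) (pow_ne_zero e hp.ne_zero)
  -- part 52
  have h := hA k hk₀ inv hsum hperf ε hμ hadd₁ hadd₂ hgal hdvd e' hμ' hadd₁' hadd₂' hgal' halt' hnondeg' inv' hperf' hcompl'
  -- the torsion factor, `p`-part: `#W(ℚ)[p^k] · #W(ℚ)[p^N] ∣ (p^{v_p #W(ℚ)_tors})²`
  have htO : Nat.card (AddCommGroup.torsion W.toAffine.Point) = W.torsionOrder := by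
    unfold WeierstrassCurve.torsionOrder; convert rfl
  have htors : Nat.card ↥(W.toAffine.Point[((p ^ k : ℕ) : ℤ)]) * Nat.card ↥(W.toAffine.Point[((p ^ N : ℕ) : ℤ)]) ≤
      (p ^ padicValNat p W.torsionOrder) ^ 2 := by
    rw [← htO, sq]
    exact Nat.le_of_dvd (Nat.mul_pos (pow_pos hp.pos _) (pow_pos hp.pos _))
      (mul_dvd_mul (natCard_torsionBy_pow_dvd_pow_padicValNat p k) (natCard_torsionBy_pow_dvd_pow_padicValNat p N))
  exact count_arith h hrle htors (pow_pos hp.pos k)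

end Count

end Summit.BirchSwinnertonDyer.BirchSwinnertonDyer.Theorems.KatoFiniteLevelCount

end
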